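import Literature.AlgebraicGeometry.HodgeTheory.CMHodgeGroupSlotsHodgeClasses
import Literature.AlgebraicGeometry.HodgeTheory.WeilTypeSixfoldHodgeGroupSUOfLie
import HarnessLib

/-!
# The coloured invariance theorem under «`Lie Hg ⊗ ℂ ⊇ 𝔲_E ∩ 𝔰𝔲_K`»: the Hodge classes on varieties with slots over `A` are killed by the typed differentials of every block family `(X_σ)_σ` with `∑_σ tr X_σ = 0` (Weil type with `End⁰ = E ⊋ K` a CM field; Moonen–Zarhin 1998 §4, 1999 (1.8)/(2.3), Deligne I §3)

Family `hodge`, layer `Literature/AlgebraicGeometry/HodgeTheory`, namespace `Literature.AlgebraicGeometry.HodgeTheory`.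
THEOREMS ONLY: no definition, no named fact, no `sorry` (D-0026). Written for the cell `pub-hodgeav-hg6` (req-37 (A) Q2b,
TABLE X rows 11 ∕ 13: Weil-type sixfolds with `End⁰ = E ⊋ K`), seat eng-3 g3, brick **B5a-E, part 1** (design memo
`HOME/jobs/WEIL-EK-eng3g3/DESIGN.md`). HONEST FRAMING: HC ∕ HC_AV (stmt-1333) ∕ HC_CM (stmt-3052) ∕ H2 NOT proved; the Lie
hypothesis `hSU` below is DISPLAYED, never discharged here.

WHAT. The tree's `AVSlots.exists_cmInvariant_coeff_of_hodgeLieC` (`CMHodgeGroupSlotsHodgeClasses`) is the coloured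
invariance theorem under «`Hg = U_E`» (`hU`: EVERY `φ_ℂ`-commuting `ψ_ℂ`-skew operator lies in `Lie Hg ⊗ ℂ`): one colour `k`
and one matrix `X ∈ 𝔤𝔩_{n₀}` at a time. For an abelian variety of Weil type `(A, K)` with `End⁰(A) = E ⊋ K` the Hodge Lie
algebra is at most `𝔲_E ∩ 𝔰𝔲_K` (the Weil classes `W_K` are Hodge, MZ98 §4), so the right hypothesis is the WEAKER
`hSU`: «every operator commuting with `φ_ℂ` (the generator of `K`) and with `φ_{E,ℂ}` (the generator of `E`), `ψ_ℂ`-skew,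
and with TRACE ZERO on `W_K = ker(φ_ℂ − μ_K)` lies in `Lie Hg ⊗ ℂ`» (= brick B4′'s shape with one more commutation), and the
right conclusion is invariance under the typed differential of every FAMILY `(X_k)_k` of blocks, `X_k` on the `W_{μ k}`-letters
and `−X_kᵀ` on the `W_{μ̄ k}`-letters, with `∑_k tr X_k = 0` — the adapted letters of type `0` being chosen INSIDE `W_K`
(the CM type `μ` is the `K`-fibre: `W_{μ k} ⊆ W_K`, `W_{μ̄ k} ⊆ W̄_K`). This file proves exactly that
(**`AVSlots.exists_suInvariant_coeff_of_hodgeLieC`**, §1); the letter transport is VERBATIM that of the tree theorem (credited),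
the new lines are the trace computation (§0: the type-`0` letters are a basis of `W_K`, in which the operator `⊕_k (X_k ⊕ −X_kᵀ)`
has the block matrix `(X_k)_k`, trace `∑_k tr X_k`). Part 2 (`WeilTypeCMFieldHodgeGroupUEOfLie`) turns this into the
group statement «`U_E(ℂ) ∩ SU_K ⊆ Hg(A)(ℂ)|_{H¹}`» by the coloured `SL` theorem
(`ClassicalInvariants/MixedTensorLieInvariantsSLColoured`) and a torus argument.

## References
* [MoonenZarhin1998WeilClasses] B. Moonen, Yu. Zarhin, Weil classes on abelian varieties, J. reine angew. Math. 496 (1998), §4 Remark (1).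
* [MoonenZarhin1999LowDim] B. Moonen, Yu. Zarhin, Math. Ann. 315 (1999), §1 (1.8), §2 (2.3), §3 (3.1).
* [Deligne1982HodgeCycles] P. Deligne, LNM 900 (1982), I §3 Prop. 3.4, §4 (p. 30).
* [Gordon1997] B. B. Gordon, arXiv:alg-geom/9709030, §6 pp. 18–19.
* [GoodmanWallachGTM255] R. Goodman, N. R. Wallach, GTM 255 (2009), §4.1.1.
-/

noncomputable section

open scoped TensorProduct
open scoped Matrix
open CategoryTheory Module

namespace Literature.AlgebraicGeometry.HodgeTheory

open Literature.AlgebraicTopology.SingularHomology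
open Literature.AlgebraicGeometry.Motives (IsSmoothProjective AbelianVariety bettiCohomology
  ofRatClassBaseChange ofRatClassBaseChange_tmul HodgeTensorFacts hodgeTensorFacts_holds)
open Literature.AlgebraicGeometry.Motives.HodgeStructure
open Literature.RepresentationTheory.GeneralLinear
open Literature.RepresentationTheory.ClassicalInvariants
open Literature.NumberTheory.DiophantineGeometry

/-! ### §0 Linear algebra: bases of eigenspaces cut out of block bases, matrices of restrictions (any index types) -/

section LinearAlgebraGen

variable {K V : Type*} [Field K] [AddCommGroup V] [Module K V] {T L : Type*} [Fintype T] [Fintype L]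

/-- **A block of a block basis is a basis of its eigenspace** (general index types): if `cb` is a basis indexed by `T × L`
on whose blocks `f` acts by scalars `ε τ`, and `τ₀` is the only block with scalar `μ`, then `ℓ ↦ cb (τ₀, ℓ)` is a basis of
`ker(f − μ)`. (The tree's `exists_basis_eigenspace_of_block` is `T = Fin 2`, `L = Fin k`.) [cite: vanGeemen1994HodgeAV, Lemma 6.10 (proof)] -/
theorem exists_basis_eigenspace_of_blocks (cb : Module.Basis (T × L) K V) {f : Module.End K V} {ε : T → K}
    (hf : ∀ τ ℓ, f (cb (τ, ℓ)) = ε τ • cb (τ, ℓ)) (τ₀ : T) {μ : K} (hτ₀ : ε τ₀ = μ) (hne : ∀ τ, τ ≠ τ₀ → ε τ ≠ μ) :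
    ∃ bW : Module.Basis L K (Module.End.eigenspace f μ), ∀ ℓ, (bW ℓ : V) = cb (τ₀, ℓ) := by
  classical
  have hmem : ∀ ℓ, cb (τ₀, ℓ) ∈ Module.End.eigenspace f μ := fun ℓ =>
    Module.End.mem_eigenspace_iff.2 (by rw [hf, hτ₀])
  set v : L → Module.End.eigenspace f μ := fun ℓ => ⟨cb (τ₀, ℓ), hmem ℓ⟩ with hv
  have hli : LinearIndependent K v := by
    refine LinearIndependent.of_comp (Module.End.eigenspace f μ).subtype ?_
    have h : (Module.End.eigenspace f μ).subtype ∘ v = cb ∘ fun ℓ => (τ₀, ℓ) := rfl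
    rw [h]
    exact cb.linearIndependent.comp _ fun _ _ h' => (Prod.mk.inj h').2
  have hsp : ⊤ ≤ Submodule.span K (Set.range v) := by
    rintro ⟨w, hw⟩ -
    set c := cb.repr w with hc
    have hφw : f w = μ • w := Module.End.mem_eigenspace_iff.1 hw
    have hsum : w = ∑ tl : T × L, c tl • cb tl := (cb.sum_repr w).symm
    have h1 : f w = ∑ tl : T × L, (c tl * ε tl.1) • cb tl := by
      conv_lhs => rw [hsum]
      rw [map_sum]
      exact Finset.sum_congr rfl fun tl _ => by rw [map_smul, hf, smul_smul]
    have h2 : f w = ∑ tl : T × L, (μ * c tl) • cb tl := by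
      rw [hφw, hsum, Finset.smul_sum]
      exact Finset.sum_congr rfl fun tl _ => by rw [smul_smul]
    have hcoef : ∀ tl : T × L, c tl * ε tl.1 = μ * c tl := fun tl => by
      have e1 := congrArg (fun x => cb.repr x tl) h1
      have e2 := congrArg (fun x => cb.repr x tl) h2
      simp only [cb.repr_sum_self] at e1 e2
      rw [← e1, ← e2]
    have hoff : ∀ tl : T × L, tl.1 ≠ τ₀ → c tl = 0 := fun tl htl => by
      have h := hcoef tl
      rw [mul_comm] at h
      by_contra hc0
      exact hne tl.1 htl (mul_right_cancel₀ hc0 h)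
    have hw' : w = ∑ ℓ, c (τ₀, ℓ) • cb (τ₀, ℓ) := by
      rw [hsum, Fintype.sum_prod_type, Finset.sum_eq_single τ₀]
      · intro τ' _ hτ'
        exact Finset.sum_eq_zero fun ℓ _ => by rw [hoff (τ', ℓ) hτ', zero_smul]
      · intro h; exact absurd (Finset.mem_univ τ₀) h
    have hmemspan : (⟨w, hw⟩ : Module.End.eigenspace f μ) = ∑ ℓ, c (τ₀, ℓ) • v ℓ := by
      apply Subtype.ext
      rw [Submodule.coe_sum]
      change w = _
      rw [hw']
      exact Finset.sum_congr rfl fun ℓ _ => rfl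
    rw [hmemspan]
    exact Submodule.sum_mem _ fun ℓ _ => Submodule.smul_mem _ _ (Submodule.subset_span ⟨ℓ, rfl⟩)
  exact ⟨Module.Basis.mk hli hsp, fun ℓ => by rw [Module.Basis.mk_apply]⟩

variable [DecidableEq L] in
/-- **The matrix of a restriction in a given basis of the invariant submodule** (any finite index type).
[cite: GoodmanWallachGTM255, §4.1.1] -/
theorem toMatrix_restrict_eq_of_apply_eq_sum' {W : Submodule K V} (bW : Module.Basis L K W) {e : L → V}
    (hbW : ∀ ℓ, (bW ℓ : V) = e ℓ) {Y : Module.End K V} (hYW : ∀ x ∈ W, Y x ∈ W) (X : Matrix L L K)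
    (hY : ∀ ℓ, Y (e ℓ) = ∑ r, X r ℓ • e r) :
    LinearMap.toMatrix bW bW (Y.restrict hYW) = X := by
  ext r ℓ
  have h : (Y.restrict hYW) (bW ℓ) = ∑ r', X r' ℓ • bW r' := by
    apply Subtype.ext
    rw [LinearMap.coe_restrict_apply, hbW, hY, Submodule.coe_sum]
    exact Finset.sum_congr rfl fun r' _ => by rw [Submodule.coe_smul, hbW]
  rw [LinearMap.toMatrix_apply, h, bW.repr_sum_self]

end LinearAlgebraGen

/-! ### §1 INVARIANCE under «`Lie Hg ⊗ ℂ ⊇ 𝔲_E ∩ 𝔰𝔲_K`»: the slices are killed by every traceless block family -/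

section SUInvariance

variable {A B : AbelianVariety ℂ} {n : ℕ} {g : Fin n → (B ⟶ A)} {ι : Type} [Fintype ι] [DecidableEq ι]

/-- The two elements of `Fin 2`. [folklore] -/
private theorem fin2_cases'' (r : Fin 2) : r = 0 ∨ r = 1 := by
  fin_cases r <;> simp

open scoped Classical in
/-- **THE COLOURED INVARIANCE THEOREM under the displayed Lie hypothesis «`Lie Hg ⊗ ℂ ⊇ 𝔲_E ∩ 𝔰𝔲_K`»** (Weil type with
`End⁰ = E ⊋ K`). Data: `A` a complex abelian variety, `ψ` a polarization of `H¹(A(ℂ); ℚ)`, `φ` (generator of `E`) and `φK`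
(generator of `K`) Hodge endomorphisms, `hSU`: every operator commuting with `φK_ℂ` and with `φ_ℂ`, `ψ_ℂ`-skew and with
trace `0` on `W_K = ker(φK_ℂ − μK)` lies in `Lie Hg ⊗ ℂ`; adapted `ψ_ℂ`-dual coloured letters `cb ((k,t),ℓ)` (as produced by
`CMTheta.exists_adaptedDualBasis`) whose type-`0` letters lie in `W_K` and type-`1` letters in `ker(φK_ℂ − μK')`, `μK' ≠ μK`;
and `B` with slots `g` over `A`. Then every rational `(p,p)`-class on `B` (`p ≥ 1`) is `∑_w a(w)·(g cb)_w` for a coefficient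
function `a` on slot-colour-type words such that for every such word `U` and EVERY block family `(X_k)_k`, `X_k ∈ 𝔤𝔩_{n₀}(ℂ)`,
with `∑_k tr X_k = 0`, the typed differential (`X_k` at the type-`0` positions of colour `k`, `−X_kᵀ` at the type-`1`
positions of colour `k`) kills the slice `a(U, −)`. The operator `Y = ⊕_k (X_k ⊕ −X_kᵀ)` commutes with `φ_ℂ` and `φK_ℂ`
(blockwise scalars), is `ψ_ℂ`-skew (the pairing table) and has `tr(Y|W_K) = ∑_k tr X_k = 0` (§0), so `hSU` puts it in
`Lie Hg ⊗ ℂ` and Theorem L-Hg (`wordDerAt_eq_zero_of_mem_hodgeLieC`, Deligne's rigidity) kills the rational coefficient tensor.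
The letter transport is that of the tree's `AVSlots.exists_cmInvariant_coeff_of_hodgeLieC` (credited, not re-proved in
substance). [cite: Deligne1982HodgeCycles, I §3 Prop. 3.4 and §4 (p. 30)] [cite: MoonenZarhin1999LowDim, §1 (1.8), §2 (2.3) and §3 (3.1)]
[cite: MoonenZarhin1998WeilClasses, §4 Remark (1)] [cite: Gordon1997, §6 (pp. 18–19)] -/
theorem AVSlots.exists_suInvariant_coeff_of_hodgeLieC [HodgeTensorFacts.{0, 0}] (hg : AVSlots A B g)
    (hHD : exists_isReal_hodgeModel) (hI : hodgePQ_independent_of_hodgeModel)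
    (ψ : (BettiUniverse.hodge hHD (AbelianVariety.isSmoothProjective_holds (A := A)) 1).Polarization)
    {φ φK : Module.End ℚ (bettiCohomology A.X 1)} {μK μK' : ℂ} (hμK : μK' ≠ μK)
    (hSU : ∀ (Y : Module.End ℂ (ℂ ⊗[ℚ] bettiCohomology A.X 1)) (hYφ : Y * φK.baseChange ℂ = φK.baseChange ℂ * Y),
      Y * φ.baseChange ℂ = φ.baseChange ℂ * Y →
      (∀ x y, ψ.form.baseChange ℂ (Y x) y + ψ.form.baseChange ℂ x (Y y) = 0) →
      LinearMap.trace ℂ _ (Y.restrict fun x (hx : x ∈ Module.End.eigenspace (φK.baseChange ℂ) μK) =>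
        UnitaryTheta.apply_mem_eigenspace_of_commute hYφ hx) = 0 →
      Y ∈ (BettiUniverse.hodge hHD (AbelianVariety.isSmoothProjective_holds (A := A)) 1).hodgeLieC)
    (μ : ι → ℂ) {n₀ : ℕ} (cb : Module.Basis ((ι × Fin 2) × Fin n₀) ℂ (ℂ ⊗[ℚ] bettiCohomology A.X 1))
    (κ : ι × Fin n₀ → Fin 2)
    (hcbW : ∀ k ℓ, cb ((k, 0), ℓ) ∈ Module.End.eigenspace (φ.baseChange ℂ) (μ k))
    (hcbW' : ∀ k ℓ, cb ((k, 1), ℓ) ∈ Module.End.eigenspace (φ.baseChange ℂ) (starRingEnd ℂ (μ k)))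
    (hKcb : ∀ k ℓ, cb ((k, 0), ℓ) ∈ Module.End.eigenspace (φK.baseChange ℂ) μK)
    (hKcb' : ∀ k ℓ, cb ((k, 1), ℓ) ∈ Module.End.eigenspace (φK.baseChange ℂ) μK')
    (hcb0 : ∀ k ℓ, κ (k, ℓ) = 0 →
      cb ((k, 0), ℓ) ∈ (BettiUniverse.hodge hHD (AbelianVariety.isSmoothProjective_holds (A := A)) 1).piece 1 0 ∧
      cb ((k, 1), ℓ) ∈ (BettiUniverse.hodge hHD (AbelianVariety.isSmoothProjective_holds (A := A)) 1).piece 0 1)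
    (hcb1 : ∀ k ℓ, κ (k, ℓ) = 1 →
      cb ((k, 0), ℓ) ∈ (BettiUniverse.hodge hHD (AbelianVariety.isSmoothProjective_holds (A := A)) 1).piece 0 1 ∧
      cb ((k, 1), ℓ) ∈ (BettiUniverse.hodge hHD (AbelianVariety.isSmoothProjective_holds (A := A)) 1).piece 1 0)
    (hdual : ∀ k k' i j, ψ.form.baseChange ℂ (cb ((k, 0), i)) (cb ((k', 1), j)) =
      if k = k' ∧ i = j then 1 else 0)
    (hiso : ∀ k k' (t : Fin 2) i j, ψ.form.baseChange ℂ (cb ((k, t), i)) (cb ((k', t), j)) = 0)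
    {p : ℕ} (hp : 0 < p) {c : complexBetti B.X (2 * p)} (hcQ : IsRationalClass c)
    (hc : IsOfHodgeType B.dim B.X (2 * p) p p c) :
    ∃ a : (Fin (2 * p) → (Fin n × (ι × Fin 2)) × Fin n₀) → ℂ,
      wordEval (cupPowOneAlt ℂ (Motives.ComplexPoints B.X) (2 * p))
        (fun x : (Fin n × (ι × Fin 2)) × Fin n₀ => avLetters g (fun tl : (ι × Fin 2) × Fin n₀ =>
          ofRatClassBaseChange (Motives.ComplexPoints A.X) 1 (cb tl)) (x.1.1, (x.1.2, x.2))) a = c ∧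
      ∀ (U : Fin (2 * p) → Fin n × (ι × Fin 2)) (Xf : ι → Matrix (Fin n₀) (Fin n₀) ℂ), (∑ k, (Xf k).trace) = 0 →
        wordDerAt ℂ (fun t => if (U t).2.2 = 0 then Xf (U t).2.1 else -(Xf (U t).2.1)ᵀ) (wordSlice a U) = 0 := by
  classical
  -- (the letter transport below is that of `AVSlots.exists_cmInvariant_coeff_of_hodgeLieC`)
  -- the setting
  have hX : IsSmoothProjective A.dim A.X := AbelianVariety.isSmoothProjective_holds
  haveI : Module.Finite ℚ (bettiCohomology A.X 1) := finite_bettiCohomology_one A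
  have hn1 : (((1 : ℕ) : ℤ)) = 1 := Nat.cast_one
  have heff := BettiUniverse.hodge_isEffective hHD hX 1
  set F := cupPowOneAlt ℂ (Motives.ComplexPoints B.X) (2 * p) with hFdef
  have hFinj : Function.Injective (exteriorPower.alternatingMapLinearEquiv F) :=
    injective_alternatingMapLinearEquiv_cupPowOneAlt B (2 * p)
  -- bases: the adapted basis `cbσ` and the rational basis `eC`, both indexed by `Fin M`
  set eQ := Module.finBasis ℚ (bettiCohomology A.X 1) with heQ
  set eC : Module.Basis (Fin (Module.finrank ℚ (bettiCohomology A.X 1))) ℂ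
    (ℂ ⊗[ℚ] bettiCohomology A.X 1) := Algebra.TensorProduct.basis ℂ eQ with heC
  set φι : Fin (Module.finrank ℚ (bettiCohomology A.X 1)) ≃ (ι × Fin 2) × Fin n₀ := eC.indexEquiv cb with hφι
  set cbσ : Module.Basis (Fin (Module.finrank ℚ (bettiCohomology A.X 1))) ℂ
    (ℂ ⊗[ℚ] bettiCohomology A.X 1) := cb.reindex φι.symm with hcbσdef
  have hcbσ : ∀ m, cbσ m = cb (φι m) := fun m => by
    rw [hcbσdef, Module.Basis.reindex_apply, Equiv.symm_symm]
  -- kinds of the adapted letters (covectors have the opposite kind)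
  set κ2 : (ι × Fin 2) × Fin n₀ → Fin 2 := fun x =>
    if x.1.2 = 0 then κ (x.1.1, x.2) else (if κ (x.1.1, x.2) = 0 then 1 else 0) with hκ2
  have hkind : ∀ x : (ι × Fin 2) × Fin n₀,
      (κ2 x = 0 → cb x ∈ (BettiUniverse.hodge hHD (AbelianVariety.isSmoothProjective_holds (A := A)) 1).piece 1 0) ∧
      (κ2 x = 1 → cb x ∈ (BettiUniverse.hodge hHD (AbelianVariety.isSmoothProjective_holds (A := A)) 1).piece 0 1) := by
    rintro ⟨⟨k, t⟩, ℓ⟩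
    rcases fin2_cases'' t with rfl | rfl <;> rcases fin2_cases'' (κ (k, ℓ)) with h | h
    · have hk : κ2 ((k, 0), ℓ) = 0 := by simp [hκ2, h]
      rw [hk]
      exact ⟨fun _ => (hcb0 k ℓ h).1, fun h' => absurd h' (by decide)⟩
    · have hk : κ2 ((k, 0), ℓ) = 1 := by simp [hκ2, h]
      rw [hk]
      exact ⟨fun h' => absurd h' (by decide), fun _ => (hcb1 k ℓ h).1⟩
    · have hk : κ2 ((k, 1), ℓ) = 1 := by simp [hκ2, h]
      rw [hk]
      exact ⟨fun h' => absurd h' (by decide), fun _ => (hcb0 k ℓ h).2⟩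
    · have hk : κ2 ((k, 1), ℓ) = 0 := by simp [hκ2, h]
      rw [hk]
      exact ⟨fun _ => (hcb1 k ℓ h).2, fun h' => absurd h' (by decide)⟩
  set κ' : Fin (Module.finrank ℚ (bettiCohomology A.X 1)) → Fin 2 := fun m => κ2 (φι m) with hκ'
  -- letters
  set ρ := ofRatClassBaseChangeEquiv hX 1 with hρ
  set v : Module.Basis _ ℂ (complexBetti A.X 1) := cbσ.map ρ with hv
  set eL : Module.Basis _ ℂ (complexBetti A.X 1) := eC.map ρ with heL
  have heLQ : ∀ i, IsRationalClass (eL i) := fun i => by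
    rw [heL, Module.Basis.map_apply, heC, Algebra.TensorProduct.basis_apply, hρ,
      ofRatClassBaseChangeEquiv_apply, ofRatClassBaseChange_tmul, one_smul]
    exact isRationalClass_ofRatClass _
  have hv_apply : ∀ m, v m = ofRatClassBaseChange (Motives.ComplexPoints A.X) 1 (cb (φι m)) := fun m => by
    rw [hv, Module.Basis.map_apply, hcbσ, hρ, ofRatClassBaseChangeEquiv_apply]
  have hv0 : ∀ m, κ' m = 0 → IsOfHodgeType A.dim A.X 1 1 0 (v m) := by
    intro m hm
    rw [hv_apply, ← BettiUniverse.mem_hodge_piece_iff hHD hI hX (k := 1) (p := 1) (q := 0) rfl]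
    exact (hkind (φι m)).1 hm
  have hv1 : ∀ m, κ' m = 1 → IsOfHodgeType A.dim A.X 1 0 1 (v m) := by
    intro m hm
    rw [hv_apply, ← BettiUniverse.mem_hodge_piece_iff hHD hI hX (k := 1) (p := 0) (q := 1) rfl]
    exact (hkind (φι m)).2 hm
  -- (α) an antisymmetric kind-balanced coefficient function in the adapted letters
  obtain ⟨ax, hax_bal, hax_anti, hcax⟩ := hg.exists_antisymm_kindBalanced_wordEval_eq v κ' hv0 hv1 hp hc
  -- the change of letters to the rational letters
  set G : Matrix _ _ ℂ := eC.toMatrix cbσ with hG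
  set G' : Matrix _ _ ℂ := cbσ.toMatrix eC with hG'
  have hG'G : G' * G = 1 := cbσ.toMatrix_mul_toMatrix_flip eC
  have hve : ∀ m, v m = ∑ i, G i m • eL i := fun m => by
    simp only [hv, heL, Module.Basis.map_apply, ← map_smul, ← map_sum]
    congr 1
    exact (eC.sum_toMatrix_smul_self (v := ⇑cbσ) (j := m)).symm
  have hletters : ∀ j m, avLetters g v (j, m) = ∑ i, G i m • avLetters g eL (j, i) :=
    avLetters_baseChange g G hve
  set aE := colourChangeAt (fun _ : Fin n => G) ax with haE
  have haE_anti : IsAntisymm aE := hax_anti.colourChangeAt _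
  have hcaE : wordEval F (avLetters g eL) aE = c := by
    rw [haE, ← wordEval_eq_wordEval_colourChangeAt F (fun _ : Fin n => G) hletters ax, hcax]
  -- rationality of `aE`
  obtain ⟨q, hq⟩ := hg.exists_rat_wordEval_eq eL heLQ hcQ
  obtain ⟨q', -, haEq⟩ := haE_anti.exists_eq_algebraMap_of_wordEval_eq hFinj (hg.letterBasis eL)
    (q := q) (by rw [AVSlots.coe_letterBasis, hcaE, hFdef, hq])
  have hslice_e : ∀ u, wordSlice aE u = wordRepAt ℂ (fun _ : Fin (2 * p) => G) (wordSlice ax u) :=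
    fun u => wordSlice_colourChangeAt (fun _ : Fin n => G) ax u
  -- the Hodge operator `Θ`: `diag(±1)` in the adapted letters
  obtain ⟨Θ, hΘ⟩ := exists_hodgeTheta (BettiUniverse.hodge hHD (AbelianVariety.isSmoothProjective_holds (A := A)) 1)
  obtain ⟨-, -, hΘ10, hΘ01, -⟩ :=
    UnitaryTheta.theta_facts (BettiUniverse.hodge hHD (AbelianVariety.isSmoothProjective_holds (A := A)) 1)
      hn1 heff hΘ
  have hΘb : ∀ m, Θ (cbσ m) = (if κ' m = 0 then (1 : ℂ) else -1) • cbσ m := by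
    intro m
    rw [hcbσ]
    rcases fin2_cases'' (κ' m) with h0 | h1'
    · rw [h0, if_pos rfl, one_smul]
      exact hΘ10 _ ((hkind (φι m)).1 h0)
    · rw [h1', if_neg one_ne_zero, neg_one_smul]
      exact hΘ01 _ ((hkind (φι m)).2 h1')
  have hΘcb : LinearMap.toMatrix cbσ cbσ Θ = kindDiag κ' := by
    ext i m
    rw [LinearMap.toMatrix_apply, hΘb, map_smul, Module.Basis.repr_self, Finsupp.smul_apply,
      Finsupp.single_apply, kindDiag, Matrix.diagonal_apply, smul_eq_mul, mul_ite, mul_one, mul_zero]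
    by_cases him : i = m
    · subst him; rw [if_pos rfl]
    · rw [if_neg (Ne.symm him), if_neg him]
  have hJG : LinearMap.toMatrix eC eC Θ * G = G * kindDiag κ' := by
    rw [← hΘcb, hG, linearMap_toMatrix_mul_basis_toMatrix, basis_toMatrix_mul_linearMap_toMatrix]
  have hΘq : ∀ u : Fin (2 * p) → Fin n, wordDerAt ℂ (fun _ : Fin (2 * p) => LinearMap.toMatrix eC eC Θ)
      (wordSlice (fun w => algebraMap ℚ ℂ (q' w)) u) = 0 := by
    intro u
    rw [← haEq, hslice_e]
    refine wordDerAt_wordRepAt_eq_zero_of_mul_eq ℂ (fun _ : Fin (2 * p) => G) (fun _ => hJG) ?_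
    rw [wordDerAt_const]
    exact wordDer_kindDiag_wordSlice_eq_zero κ' hax_bal u
  -- structure constants of `ψ_ℂ`, `φ_ℂ` and `φK_ℂ` in the adapted basis
  set ψC := ψ.form.baseChange ℂ with hψC
  have hswap : ∀ x y, ψC y x = -ψC x y := fun x y => by
    rw [hψC, ψ.form_baseChange_swap, show (((1 : ℕ) : ℤ)).negOnePow = -1 from Int.negOnePow_one]
    simp
  have hdual_same : ∀ k i j, ψC (cb ((k, 0), i)) (cb ((k, 1), j)) = if i = j then 1 else 0 := fun k i j => by
    rw [hψC, hdual]; simp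
  have hswap_same : ∀ k i j, ψC (cb ((k, 1), i)) (cb ((k, 0), j)) = -(if j = i then 1 else 0) := fun k i j => by
    rw [hswap, hdual_same]
  have hpair0 : ∀ k₁ k₂ (t₁ t₂ : Fin 2) i j, k₁ ≠ k₂ → ψC (cb ((k₁, t₁), i)) (cb ((k₂, t₂), j)) = 0 := by
    intro k₁ k₂ t₁ t₂ i j hk
    rcases fin2_cases'' t₁ with rfl | rfl <;> rcases fin2_cases'' t₂ with rfl | rfl
    · exact hiso k₁ k₂ 0 i j
    · rw [hψC, hdual, if_neg (fun h => hk h.1)]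
    · rw [hswap, hψC, hdual, if_neg (fun h => hk h.1.symm), neg_zero]
    · exact hiso k₁ k₂ 1 i j
  set ev : ι × Fin 2 → ℂ := fun kt => if kt.2 = 0 then μ kt.1 else starRingEnd ℂ (μ kt.1) with hev
  have hφcb : ∀ (kt : ι × Fin 2) ℓ, φ.baseChange ℂ (cb (kt, ℓ)) = ev kt • cb (kt, ℓ) := by
    rintro ⟨k, t⟩ ℓ
    rcases fin2_cases'' t with rfl | rfl
    · simp only [hev, if_pos rfl]; exact Module.End.mem_eigenspace_iff.1 (hcbW k ℓ)
    · simp only [hev, if_neg one_ne_zero]; exact Module.End.mem_eigenspace_iff.1 (hcbW' k ℓ)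
  set evK : ι × Fin 2 → ℂ := fun kt => if kt.2 = 0 then μK else μK' with hevK
  have hφKcb : ∀ (kt : ι × Fin 2) ℓ, φK.baseChange ℂ (cb (kt, ℓ)) = evK kt • cb (kt, ℓ) := by
    rintro ⟨k, t⟩ ℓ
    rcases fin2_cases'' t with rfl | rfl
    · simp only [hevK, if_pos rfl]; exact Module.End.mem_eigenspace_iff.1 (hKcb k ℓ)
    · simp only [hevK, if_neg one_ne_zero]; exact Module.End.mem_eigenspace_iff.1 (hKcb' k ℓ)
  -- a basis of `W_K = ker(φK_ℂ − μK)` made of the type-`0` letters, indexed by `Fin n₀ × ι`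
  set eW : Fin 2 × (Fin n₀ × ι) ≃ (ι × Fin 2) × Fin n₀ :=
    { toFun := fun x => ((x.2.2, x.1), x.2.1)
      invFun := fun y => (y.1.2, (y.2, y.1.1))
      left_inv := fun x => rfl
      right_inv := fun y => rfl } with heW
  set cbW : Module.Basis (Fin 2 × (Fin n₀ × ι)) ℂ (ℂ ⊗[ℚ] bettiCohomology A.X 1) := cb.reindex eW.symm with hcbWdef
  have hcbW_apply : ∀ (t : Fin 2) (r : Fin n₀) (k : ι), cbW (t, (r, k)) = cb ((k, t), r) := fun t r k => by
    rw [hcbWdef, Module.Basis.reindex_apply, Equiv.symm_symm]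
    rfl
  obtain ⟨bW, hbW⟩ := exists_basis_eigenspace_of_blocks cbW (f := φK.baseChange ℂ) (ε := ![μK, μK'])
    (fun t rk => by
      obtain ⟨r, k⟩ := rk
      rw [hcbW_apply, hφKcb]
      rcases fin2_cases'' t with rfl | rfl
      · simp [hevK]
      · simp [hevK])
    0 (μ := μK) (by simp) (fun t ht => by
      rcases fin2_cases'' t with rfl | rfl
      · exact absurd rfl ht
      · simpa using hμK)
  have hbW' : ∀ rk : Fin n₀ × ι, (bW rk : ℂ ⊗[ℚ] bettiCohomology A.X 1) = cb ((rk.2, 0), rk.1) := fun rk => by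
    rw [hbW, hcbW_apply]
  -- the invariance of every slice under the traceless block families, via `hSU` and THEOREM L-Hg
  have key : ∀ (Xf : ι → Matrix (Fin n₀) (Fin n₀) ℂ), (∑ k, (Xf k).trace) = 0 → ∀ (u : Fin (2 * p) → Fin n),
      wordDerAt ℂ (fun _ : Fin (2 * p) => blockLiftGen φι (fun kt : ι × Fin 2 =>
        if kt.2 = 0 then Xf kt.1 else -(Xf kt.1)ᵀ)) (wordSlice ax u) = 0 := by
    intro Xf hXtr u
    set Nf : ι × Fin 2 → Matrix (Fin n₀) (Fin n₀) ℂ := fun kt => if kt.2 = 0 then Xf kt.1 else -(Xf kt.1)ᵀ with hNf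
    have hNf0 : ∀ k, Nf (k, 0) = Xf k := fun k => by simp [hNf]
    have hNf1 : ∀ k, Nf (k, 1) = -(Xf k)ᵀ := fun k => by simp [hNf]
    set Y := Matrix.toLin cbσ cbσ (blockLiftGen φι Nf) with hYdef
    have hYcb : ∀ (kt : ι × Fin 2) ℓ, Y (cb (kt, ℓ)) = ∑ r, Nf kt r ℓ • cb (kt, r) :=
      fun kt ℓ => toLin_blockLiftGen_apply φι cbσ (⇑cb) hcbσ Nf kt ℓ
    have hYφ : Y * φ.baseChange ℂ = φ.baseChange ℂ * Y := by
      refine cb.ext fun x => ?_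
      obtain ⟨kt, ℓ⟩ := x
      rw [Module.End.mul_apply, Module.End.mul_apply, hφcb, map_smul, hYcb, map_sum, Finset.smul_sum]
      exact Finset.sum_congr rfl fun r _ => by rw [map_smul, hφcb, smul_comm]
    have hYφK : Y * φK.baseChange ℂ = φK.baseChange ℂ * Y := by
      refine cb.ext fun x => ?_
      obtain ⟨kt, ℓ⟩ := x
      rw [Module.End.mul_apply, Module.End.mul_apply, hφKcb, map_smul, hYcb, map_sum, Finset.smul_sum]
      exact Finset.sum_congr rfl fun r _ => by rw [map_smul, hφKcb, smul_comm]
    have hYskew : ∀ x y, ψC (Y x) y + ψC x (Y y) = 0 := by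
      have hB : ψC ∘ₗ Y + ψC.compl₂ Y = 0 := by
        refine LinearMap.BilinForm.ext_basis cb fun x₁ x₂ => ?_
        obtain ⟨⟨k₁, t₁⟩, i⟩ := x₁
        obtain ⟨⟨k₂, t₂⟩, j⟩ := x₂
        rw [LinearMap.add_apply, LinearMap.add_apply, LinearMap.comp_apply, LinearMap.compl₂_apply,
          LinearMap.zero_apply, LinearMap.zero_apply, hYcb, hYcb, map_sum, LinearMap.sum_apply, map_sum]
        simp only [map_smul, LinearMap.smul_apply, smul_eq_mul]
        by_cases hk12 : k₁ = k₂
        · subst hk12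
          rcases fin2_cases'' t₁ with rfl | rfl <;> rcases fin2_cases'' t₂ with rfl | rfl
          · simp [hiso]
          · simp [hNf0, hNf1, hdual_same, Matrix.neg_apply, Matrix.transpose_apply, mul_ite, Finset.sum_ite_eq,
              Finset.sum_ite_eq']
          · simp [hNf0, hNf1, hswap_same, Matrix.neg_apply, Matrix.transpose_apply, mul_ite, Finset.sum_ite_eq,
              Finset.sum_ite_eq']
          · simp [hiso]
        · simp [hpair0 k₁ k₂ t₁ t₂ _ _ hk12]
      intro x y
      have h := LinearMap.congr_fun (LinearMap.congr_fun hB x) y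
      simpa only [LinearMap.add_apply, LinearMap.comp_apply, LinearMap.compl₂_apply, LinearMap.zero_apply]
        using h
    -- the trace of `Y` on `W_K` is `∑_k tr X_k = 0`
    have hYtr : LinearMap.trace ℂ _ (Y.restrict fun x (hx : x ∈ Module.End.eigenspace (φK.baseChange ℂ) μK) =>
        UnitaryTheta.apply_mem_eigenspace_of_commute hYφK hx) = 0 := by
      set Mx : Matrix (Fin n₀ × ι) (Fin n₀ × ι) ℂ := Matrix.of fun x y => if x.2 = y.2 then Xf y.2 x.1 y.1 else 0
        with hMx
      have hYW : ∀ rk : Fin n₀ × ι, Y (cb ((rk.2, 0), rk.1)) = ∑ x : Fin n₀ × ι, Mx x rk • cb ((x.2, 0), x.1) := by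
        rintro ⟨ℓ, k⟩
        rw [hYcb, hNf0, Fintype.sum_prod_type_right, Finset.sum_eq_single k]
        · exact Finset.sum_congr rfl fun r _ => by simp [hMx]
        · intro k' _ hk'
          exact Finset.sum_eq_zero fun r _ => by simp [hMx, hk']
        · intro hk; exact absurd (Finset.mem_univ k) hk
      rw [LinearMap.trace_eq_matrix_trace ℂ bW, toMatrix_restrict_eq_of_apply_eq_sum' bW hbW' _ Mx hYW,
        Matrix.trace, Fintype.sum_prod_type_right]
      simp only [Matrix.diag_apply, hMx, Matrix.of_apply, if_true]
      rw [← hXtr]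
      exact Finset.sum_congr rfl fun k _ => by rw [Matrix.trace]; rfl
    have hYC := hSU Y hYφK hYφ hYskew hYtr
    have hL := wordDerAt_eq_zero_of_mem_hodgeLieC
      (BettiUniverse.hodge hHD (AbelianVariety.isSmoothProjective_holds (A := A)) 1) ψ eQ q' hΘ hΘq hYC u
    rw [← haEq, hslice_e] at hL
    have hYG : ∀ _t : Fin (2 * p), LinearMap.toMatrix eC eC Y * G = G * LinearMap.toMatrix cbσ cbσ Y :=
      fun _ => by rw [hG, linearMap_toMatrix_mul_basis_toMatrix, basis_toMatrix_mul_linearMap_toMatrix]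
    have hblk : LinearMap.toMatrix cbσ cbσ Y = blockLiftGen φι Nf := by
      rw [hYdef, LinearMap.toMatrix_toLin]
    have h3 : wordRepAt ℂ (fun _ : Fin (2 * p) => G)
        (wordDerAt ℂ (fun _ : Fin (2 * p) => blockLiftGen φι Nf) (wordSlice ax u)) = 0 := by
      rw [← hblk, wordRepAt_wordDerAt_of_mul_eq ℂ (fun _ : Fin (2 * p) => G) hYG, hL]
    exact wordRepAt_injective ℂ (g := fun _ : Fin (2 * p) => G) (g' := fun _ : Fin (2 * p) => G')
      (funext fun _ => hG'G) (by rw [h3, map_zero])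
  -- the coefficient function, refined to slot-and-(colour, type) letters
  refine ⟨placeRefineGen φι ax, ?_, fun U Xf hXtr => ?_⟩
  · rw [← hcax]
    have hx : (fun x : (Fin n × (ι × Fin 2)) × Fin n₀ => avLetters g v (x.1.1, φι.symm (x.1.2, x.2))) =
        fun x => avLetters g (fun tl : (ι × Fin 2) × Fin n₀ =>
          ofRatClassBaseChange (Motives.ComplexPoints A.X) 1 (cb tl)) (x.1.1, (x.1.2, x.2)) := by
      funext x
      rw [avLetters_apply, avLetters_apply, hv_apply, Equiv.apply_symm_apply]
    rw [← hx]
    exact wordEval_placeRefineGen F φι (avLetters g v) ax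
  · exact wordDerAt_placeRefineGen_eq_zero φι
      (fun kt : ι × Fin 2 => if kt.2 = 0 then Xf kt.1 else -(Xf kt.1)ᵀ) (key Xf hXtr) U

end SUInvariance

end Literature.AlgebraicGeometry.HodgeTheory

end
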